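import Summits.Ventures.KdS.RouteWSpinFlipProp38
import HarnessLib

/-!
# Venture KdS — what remains of H3 after the spin flip: the non-extreme lattice strata, typed

HONEST FRAMING (venture `Summits/Ventures/KdS`, cell `pub-kds`; successor object to STRUCTURE.md C3):
after `RouteWSpinFlipProp38` (`prop38_le_two`, `prop38_of_im_gt_pred_cosmo`, `prop38_of_re_ne`,
`radial_vanishing_of_im_gt`) the conclusion of the cited fact
`CasalsTeixeiraDaCosta2022_partialModeStabilityProp38` is a theorem everywhere EXCEPT on the
non-extreme strata of the cosmological lattice: `s ≥ 5/2`, `Re ω = mϖ₂`, `0 < Im ω ≤ (s−2)κ₂`,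
`s + 2B(r_c) ∈ ℤ` (kernel of the Teukolsky–Starobinsky map = branch × polynomial of positive
degree). This file TYPES that residual as ONE `Prop` (`RouteW.NonExtremeStrata`, with exactly the
binders the proof of the rest uses) and PROVES `prop38_of_nonExtremeStrata : NonExtremeStrata →
CasalsTeixeiraDaCosta2022_partialModeStabilityProp38` — i.e. H3 IN FULL reduces to it (0 facts).
A recipe for `NonExtremeStrata` (formal Euler transform of a Frobenius polynomial; termwise
intertwining identities drafted in the cell's `theory/w5/SpinFlipStrata.lean`) is in
`theory/P1-HANDOFF-g5.md`. Nothing displayed by the cell depends on it.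
-/

noncomputable section

open Set Complex

namespace Summit.Ventures.KdS

namespace RouteW

open Literature.Analysis.ODE Literature.Analysis.ODE.GeneralHeun
open Literature.Geometry.Lorentzian Literature.Geometry.Lorentzian.KerrDeSitter

/-- **The residual of H3 (typed).** CTdC Prop. 3.8's conclusion on the non-extreme strata of the
cosmological lattice: subextremal `(M,a,Λ)`, `0 ≤ a`, `2s ∈ ℤ`, `0 < Im ω ≤ (s−2)κ₂` (forces
`s > 2`), NOT off-lattice (so `Re ω = mϖ₂`, `Im ω ∈ κ₂(ℤ − s)`), `Im(λ̄ω̄) ≤ 0`,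
`|ω| ∉ |m|(0,Ω_SR)`, the pair condition for `−2(η₁+η₀)`; generic-boundary radial solutions vanish. -/
def NonExtremeStrata : Prop :=
  ∀ (M a Λ s : ℝ) (ω : ℂ) (m : ℝ) (lam : ℂ) (R : ℝ → ℂ), IsSubextremal M a Λ → 0 ≤ a →
    (∃ k : ℤ, 2 * s = k) → 0 < ω.im → ω.im ≤ (s - 2) * surfaceGravity M a Λ (rCosmo M a Λ) →
    ¬OffLattice M a Λ s ω m →
    (lambdaBar a Λ s ω m lam * (starRingEnd ℂ) ω).im ≤ 0 →
    ¬(0 < ‖ω‖ ∧ ‖ω‖ < |m| * superradiantUpper M a Λ) →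
    PairCondition (-2 * (etaEvent M a Λ ω m + etaCauchy M a Λ ω m)) →
    IsRadialTeukolskySolution M a Λ s ω m lam R → IsIngoingAtEventHorizon M a Λ s ω m R →
    IsOutgoingAtCosmoHorizon M a Λ ω m R →
      ∀ r ∈ Ioo (rPlus M a Λ) (rCosmo M a Λ), R r = 0

/-- **H3 in full reduces to the non-extreme strata.** With `NonExtremeStrata`, the cited fact
`CasalsTeixeiraDaCosta2022_partialModeStabilityProp38` holds VERBATIM (its binders `|a| < 3/Λ`,
`m − s ∈ ℤ`, `Σm_j ∉ ℤ_{≥2}`, `p₁`, `p₂`, `p₄` are not used): above `(s−2)κ₂` by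
`prop38_of_im_gt_pred_cosmo`, off the lattice by `prop38_of_im_gt_or_offLattice`, else by the
hypothesis. PROVED. -/
theorem prop38_of_nonExtremeStrata (h : NonExtremeStrata) :
    CasalsTeixeiraDaCosta2022_partialModeStabilityProp38 := by
  intro M a Λ s ω m lam hsub ha _ h2s _ hω hlam hSR _ _ _ hp₃ _ R hR hin hout
  by_cases hhi : (s - 2) * surfaceGravity M a Λ (rCosmo M a Λ) < ω.im
  · exact prop38_of_im_gt_pred_cosmo M a Λ s ω m lam hsub ha h2s hω hhi hlam hSR hp₃ R hR hin hout
  · by_cases hoff : OffLattice M a Λ s ω m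
    · exact prop38_of_im_gt_or_offLattice M a Λ s ω m lam hsub ha h2s hω hlam hSR hp₃ (Or.inr hoff)
        R hR hin hout
    · exact h M a Λ s ω m lam R hsub ha h2s hω (not_lt.mp hhi) hoff hlam hSR hp₃ hR hin hout

/-- On the residual set the spin exceeds `2` (so every spin `s ≤ 2` is fully covered). -/
theorem two_lt_of_nonExtreme {M a Λ s : ℝ} (hsub : IsSubextremal M a Λ) {ω : ℂ} (hω : 0 < ω.im)
    (hle : ω.im ≤ (s - 2) * surfaceGravity M a Λ (rCosmo M a Λ)) : 2 < s := by
  have hκ := surfaceGravity_rCosmo_pos hsub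
  by_contra hs
  have hs' : s ≤ 2 := not_lt.mp hs
  nlinarith

end RouteW

end Summit.Ventures.KdS
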